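import Summits.ResolutionOfSingularities.ResolutionOfSingularities.Theses.PAlteration
import Summits.ResolutionOfSingularities.ResolutionOfSingularities.Theses.Valuative
import Summits.ResolutionOfSingularities.ResolutionOfSingularities.Theorems.PAlterationPalterationThesisGlue
import Summits.ResolutionOfSingularities.ResolutionOfSingularities.Theorems.ValuativeTorsorToLurelOfTemkin
import HarnessLib

/-!
# Crux `PalterationThesis` (stmt-ResolutionOfSingularities-0552): the crux map from route `Valuative`, by name

Route `ResolutionOfSingularities/pAlteration`, crux
`Summit.ResolutionOfSingularities.ResolutionOfSingularities.Theses.PAlteration.PalterationThesis`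
(`= Pialt ∧ Picover`, `palterationThesis_iff_pialt_and_picover`; `↔` the summit,
`palterationThesis_iff_resolutionOfSingularities`). Line lead c5, certification file
(`--supports`; it does not close the item). Companion of `PAlterationPialtCruxMap.lean` (crux
`Pialt`, stmt-0555) and `PAlterationPicoverCruxMap.lean` / `PAlterationPicoverOfValuative.lean`
(crux `Picover`, stmt-0554): it records, BY NAME and sorry-free, the smallest set of EXISTING
ledger objects of route `Valuative` that the tree currently knows to imply this crux:

* `palterationThesis_of_valuative` — `LuAlphaPTorsor → TorsorToLurel → PatchingRel →
  PalterationThesis` (items stmt-0641, stmt-10968, stmt-0642; through `Valuative.closes` and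
  `palterationThesis_of_resolutionOfSingularities`);
* `palterationThesis_of_temkin2013Relative_luAlphaPTorsor_patchingRel` — `TorsorToLurel` is landed
  modulo the named fact `Temkin2013Relative` (Temkin 2013, Thm. 1.3.2 in relative form), so the
  crux follows from the two items stmt-0641, stmt-0642 and that published theorem;
* `palterationThesis_of_smoothFibre_luAlphaPTorsor_patchingRel` (registered sub-goal) — the same
  modulo the SINGLE remaining Literature leaf of the tree's proof cone of Temkin's theorem,
  `Temkin2013RelativeCurveSmoothFibre` (Thm. 3.3.1 for `k`-smooth generic fibres).

So, independently of the perfect-field skeleton `Cruxes/PalterationThesis/Lines/Sketch.lean`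
(whose rev. c5 stubs are stmt-0641, the fact `Temkin2013`, the two-model-patching slice of
stmt-0642 and stmt-0549 `DescentPerfectToAll`), the crux closes by composition the moment
{stmt-0641, stmt-0642, `Temkin2013RelativeCurveSmoothFibre_holds`} land — with NO descent item.
All proofs are compositions of landed theorems; no new definitions.

Sources: M. Temkin, J. Algebra 373 (2013), Thm. 1.3.2, Thm. 3.3.1, Rem. 1.3.5; O. Zariski, Ann.
of Math. 45 (1944); O. Piltant, RACSAM 107 (2013), Prop. 5.1.
-/

set_option linter.dupNamespace false -- mandated namespace of this single-conjunct summit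

noncomputable section

open Literature.AlgebraicGeometry.Resolution
open Summit.ResolutionOfSingularities.ResolutionOfSingularities

namespace Summit.ResolutionOfSingularities.ResolutionOfSingularities.Theorems.PalterationThesis.CruxMap

/-- **Route `Valuative`'s three cruxes ⟹ `PalterationThesis`**: `LuAlphaPTorsor → TorsorToLurel →
PatchingRel → PalterationThesis`, through the summit (`Valuative.closes`) and
`palterationThesis_of_resolutionOfSingularities` (a resolution is a purely inseparable regular
alteration; a radicial cover of a regular variety is a variety). [folklore] -/
theorem palterationThesis_of_valuative :
    Theses.Valuative.LuAlphaPTorsor → Theses.Valuative.TorsorToLurel →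
      Theses.Valuative.PatchingRel → Theses.PAlteration.PalterationThesis :=
  fun h₂ h₄ h₃ =>
    Theorems.palterationThesis_of_resolutionOfSingularities (Theses.Valuative.closes h₂ h₄ h₃)

/-- **`PalterationThesis` from `LuAlphaPTorsor` (stmt-0641) and `PatchingRel` (stmt-0642), modulo
Temkin's inseparable local uniformization** (named fact `Temkin2013Relative`, Temkin 2013
Thm. 1.3.2 in its relative form): `TorsorToLurel` is landed modulo it
(`torsorToLurel_of_temkin2013Relative`). [cite: Temkin2013, Thm. 1.3.2] -/
theorem palterationThesis_of_temkin2013Relative_luAlphaPTorsor_patchingRel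
    (hT : Temkin2013Relative.{0}) :
    Theses.Valuative.LuAlphaPTorsor → Theses.Valuative.PatchingRel →
      Theses.PAlteration.PalterationThesis :=
  fun h₂ h₃ => palterationThesis_of_valuative h₂ (Theorems.torsorToLurel_of_temkin2013Relative hT) h₃

/-- **`PalterationThesis` from `LuAlphaPTorsor` and `PatchingRel`, modulo the single remaining
Literature leaf `Temkin2013RelativeCurveSmoothFibre`** (Temkin 2013, Thm. 3.3.1 for `k`-smooth
generic fibres; the rest of the proof cone of Temkin's theorem is in the tree,
`torsorToLurel_of_smoothFibre`). Registered sub-goal of crux stmt-0552: its minimal by-name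
dependency on existing ledger objects. [cite: Temkin2013, Thm. 3.3.1 and Thm. 1.3.2] -/
theorem palterationThesis_of_smoothFibre_luAlphaPTorsor_patchingRel (hsf : Literature.AlgebraicGeometry.Resolution.Temkin2013RelativeCurveSmoothFibre.{0}) : Summit.ResolutionOfSingularities.ResolutionOfSingularities.Theses.Valuative.LuAlphaPTorsor → Summit.ResolutionOfSingularities.ResolutionOfSingularities.Theses.Valuative.PatchingRel → Summit.ResolutionOfSingularities.ResolutionOfSingularities.Theses.PAlteration.PalterationThesis :=
  fun h₂ h₃ => palterationThesis_of_valuative h₂ (Theorems.torsorToLurel_of_smoothFibre hsf) h₃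

end Summit.ResolutionOfSingularities.ResolutionOfSingularities.Theorems.PalterationThesis.CruxMap

end
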